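import Mathlib
import Summits.AnomalousDissipation.AnomalousDissipation.Theses.DyadicWallCascade
import Summits.AnomalousDissipation.AnomalousDissipation.Theorems.DyadicRealisation.Negative.ViscousWallProfileFalseOfLiouvilleConjectureNS

/-!
# STRATEGY CENSUS signatures — crux `ViscousContinuation` (stmt-AnomalousDissipation-17917)

Redirect strategist r1 (planner-cstrat-stmt-AnomalousDissipation-17917-r1-0, 2026-08-17), route
`DyadicWallCascade` (rev 2, `closes h₂ h₃ h₄ := steadyToSummit (h₄ (h₃ h₂))`, `h₃` = this crux).
Companion of `Cruxes/ViscousContinuation/STRATEGY-CENSUS.md`.  Everything here is kernel-checked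
(no `sorry`); it imports only the route file and the LANDED negative lemma
`ViscousWallProfile_false_of_LiouvilleConjectureNS` (p146507).

* §0 the clause blocks of the crux as predicates (verbatim the route's; `Iff.rfl` checks).
* §1 WHAT THE CRUX IS IN COSTUME.  Not the summit (the BC2 probes `C → S`, `S → C` fail, see the
  census), but: `nonvacuous_iff` — under the route's own hypothesis `h₂` the crux IS the support
  item `ViscousWallProfile` (stmt-17919); `route_requires_not_L` — `h₂` and `h₃` together REFUTE
  the tree's canonical KNSS Liouville conjecture (L); `crux_iff_not_hsh_of_L` — modulo (L) the crux
  is the NEGATION OF ITS SIBLING CRUX #2; `split_requires_not_L` / `split_some_piece_anti_L` — the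
  same holds for EVERY decomposition of the crux: the pieces, together with `h₂`, refute (L), so in
  any split some piece is (materially) anti-Liouville.
* §2 STRENGTHEN.  `GivenFieldContinuation` (continue THE given zero-stress hierarchy — the honest
  constructive form) implies the zero-stress continuation and, on any inhabited hypothesis, `¬(L)`;
  `SmallFluxContinuation δ` (the crux restricted to hypotheses with `|F| < δ`) is EQUIVALENT to the
  crux for every `δ > 0` (`smallFluxContinuation_iff`, via the amplitude scaling
  `hierarchyBody_smul : (V, Q, C, F) ↦ (tV, t²Q, (t+t²)|C|, t³F)`): the hypothesis class has no
  perturbative regime.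
* §3 DECOMPOSITION.  The far-field / capping split `FarFieldContinuation → Capping →
  ZeroStressContinuation` (typed, assembly proved) and `capping_requires_not_L`: the capping piece
  is anti-Liouville on any inhabited hypothesis; `crux_of_split` re-derives the registered
  zero-stress split direction `StressRemoval → ZeroStressContinuation → ViscousContinuation`.
* §4 NEGATION.  `not_crux_iff : ¬crux ↔ HalfSpaceHierarchy ∧ ¬ViscousWallProfile` — an
  unconditional refutation must PROVE crux #2.
-/

set_option linter.dupNamespace false
set_option linter.unusedVariables false

noncomputable section

open scoped BigOperators Topology
open Filter Set MeasureTheory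
open Summit.AnomalousDissipation.AnomalousDissipation.Theses.DyadicWallCascade
open Summit.AnomalousDissipation.AnomalousDissipation.Theorems

namespace Summit.AnomalousDissipation.AnomalousDissipation.Cruxes.ViscousContinuation.StrategyCensus

/-- Shorthand for `ℝ³`. -/
abbrev E3 : Type := EuclideanSpace ℝ (Fin 3)

/-- (L): the tree's canonical KNSS bounded-ancient-mild-solution Liouville conjecture. -/
abbrev L : Prop := Summit.NavierStokesRegularity.NavierStokesRegularity.LiouvilleConjectureNS

/-! ## §0 Clause blocks (verbatim the route's) -/

/-- The half-space-hierarchy block (clauses of `HalfSpaceHierarchy`, verbatim). -/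
def HierarchyBody (V : E3 → E3) (Q : E3 → ℝ) (C F : ℝ) : Prop :=
  let H : Set (EuclideanSpace ℝ (Fin 3)) := {X | 0 < X 2}
  let e : Fin 3 → EuclideanSpace ℝ (Fin 3) := fun i => EuclideanSpace.single i (1 : ℝ)
  let pt : ℝ × ℝ → EuclideanSpace ℝ (Fin 3) := fun q => !₂[q.1, q.2, (1 : ℝ)]
  ContDiffOn ℝ ((⊤ : ℕ∞) : WithTop ℕ∞) V H ∧ ContDiffOn ℝ ((⊤ : ℕ∞) : WithTop ℕ∞) Q H ∧
  (∀ X ∈ H, ‖V X‖ ≤ C ∧ |Q X| ≤ C) ∧ (∀ X ∈ H, ∑ i : Fin 3, (fderiv ℝ V X (e i)) i = 0) ∧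
  (∀ X ∈ H, (fderiv ℝ V X) (V X) + gradient Q X = 0) ∧
  (∀ X ∈ H, V ((2 : ℝ) • X) = V X ∧ Q ((2 : ℝ) • X) = Q X) ∧
  (∀ X : EuclideanSpace ℝ (Fin 3), 1 ≤ X 2 → X 2 ≤ 2 →
    V (X + e 0) = V X ∧ V (X + e 1) = V X ∧ Q (X + e 0) = Q X ∧ Q (X + e 1) = Q X) ∧
  (∫ q in Set.Icc (0 : ℝ) 1 ×ˢ Set.Icc (0 : ℝ) 1, (V (pt q)) 2 = 0) ∧ F ≠ 0 ∧
  (∫ q in Set.Icc (0 : ℝ) 1 ×ˢ Set.Icc (0 : ℝ) 1, (V (pt q)) 2 * (‖V (pt q)‖ ^ 2 / 2 + Q (pt q)) = F)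

/-- The viscous block (the clauses on `(W, P)` of `ViscousWallProfile`, verbatim). -/
def ViscousBody (W : E3 → E3) (P : E3 → ℝ) (V : E3 → E3) (Q : E3 → ℝ) (C' : ℝ) : Prop :=
  let e : Fin 3 → EuclideanSpace ℝ (Fin 3) := fun i => EuclideanSpace.single i (1 : ℝ)
  let σ : EuclideanSpace ℝ (Fin 3) → EuclideanSpace ℝ (Fin 3) := fun X => X - (2 * X 2) • e 2
  ContDiff ℝ ((⊤ : ℕ∞) : WithTop ℕ∞) W ∧ ContDiff ℝ ((⊤ : ℕ∞) : WithTop ℕ∞) P ∧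
  (∀ X, ‖W X‖ ≤ C' ∧ |P X| ≤ C') ∧ (∀ X, W (σ X) = σ (W X) ∧ P (σ X) = P X) ∧
  (∀ X, ∑ i : Fin 3, (fderiv ℝ W X (e i)) i = 0) ∧
  (∀ X, (fderiv ℝ W X) (W X) + gradient P X = ∑ i : Fin 3, fderiv ℝ (fun Y => fderiv ℝ W Y (e i)) X (e i)) ∧
  (∀ ε : ℝ, 0 < ε → ∃ M : ℕ, ∀ m : ℕ, M ≤ m → ∀ X : EuclideanSpace ℝ (Fin 3), 1 ≤ X 2 → X 2 ≤ 2 →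
    ‖W ((2 : ℝ) ^ m • X) - V X‖ ≤ ε ∧ |P ((2 : ℝ) ^ m • X) - Q X| ≤ ε)

/-- Zero Reynolds stress of the hierarchy on the unit square of `z = 1` (the two clauses of the
registered stub `stub_zeroStressContinuation`'s hypothesis). -/
def ZeroStress (V : E3 → E3) : Prop :=
  let pt : ℝ × ℝ → EuclideanSpace ℝ (Fin 3) := fun q => !₂[q.1, q.2, (1 : ℝ)]
  (∫ q in Set.Icc (0 : ℝ) 1 ×ˢ Set.Icc (0 : ℝ) 1, (V (pt q)) 2 * (V (pt q)) 0 = 0) ∧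
  (∫ q in Set.Icc (0 : ℝ) 1 ×ˢ Set.Icc (0 : ℝ) 1, (V (pt q)) 2 * (V (pt q)) 1 = 0)

theorem halfSpaceHierarchy_iff : HalfSpaceHierarchy ↔ ∃ V Q C F, HierarchyBody V Q C F := Iff.rfl

theorem viscousWallProfile_iff :
    ViscousWallProfile ↔ ∃ W P V Q C F C', HierarchyBody V Q C F ∧ ViscousBody W P V Q C' := Iff.rfl

theorem viscousContinuation_iff : ViscousContinuation ↔ (HalfSpaceHierarchy → ViscousWallProfile) :=
  Iff.rfl

/-! ## §1 What the crux is in costume -/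

/-- The conclusion of the crux contains its hypothesis (projection). -/
theorem viscousWallProfile_imp_hsh : ViscousWallProfile → HalfSpaceHierarchy := by
  rw [viscousWallProfile_iff, halfSpaceHierarchy_iff]
  rintro ⟨W, P, V, Q, C, F, C', hH, -⟩
  exact ⟨V, Q, C, F, hH⟩

/-- **Under the route's own hypothesis the crux IS the support item stmt-17919.** -/
theorem nonvacuous_iff : (HalfSpaceHierarchy ∧ ViscousContinuation) ↔ ViscousWallProfile :=
  ⟨fun h => h.2 h.1, fun h => ⟨viscousWallProfile_imp_hsh h, fun _ => h⟩⟩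

/-- A refutation of crux #2 proves the crux (vacuously) — and closes the route `refuted`. -/
theorem crux_of_not_hsh (h : ¬ HalfSpaceHierarchy) : ViscousContinuation := fun h2 => (h h2).elim

/-- **The route instantiates `closes h₂ h₃ h₄` only by refuting (L):** the hypotheses `h₂` (crux
#2) and `h₃` (this crux) together contradict the KNSS Liouville conjecture (landed p146507). -/
theorem route_requires_not_L (h₂ : HalfSpaceHierarchy) (h₃ : ViscousContinuation) : ¬ L :=
  fun hL => ViscousWallProfile_false_of_LiouvilleConjectureNS hL (h₃ h₂)

/-- **Modulo (L) the crux is the negation of its sibling crux #2.** -/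
theorem crux_iff_not_hsh_of_L (hL : L) : ViscousContinuation ↔ ¬ HalfSpaceHierarchy :=
  ⟨fun h h2 => ViscousWallProfile_false_of_LiouvilleConjectureNS hL (h h2), crux_of_not_hsh⟩

/-- **Decomposition meta-theorem.**  For ANY split of the crux — pieces with conjunction `P` and
a proved assembly `P → ViscousContinuation` — the pieces together with the route's `h₂` refute (L).
No cut of the crux makes the union of its pieces easier than `¬(L) ∨ ¬(crux #2)`. -/
theorem split_requires_not_L {P : Prop} (assembly : P → ViscousContinuation)
    (h₂ : HalfSpaceHierarchy) (hP : P) : ¬ L :=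
  route_requires_not_L h₂ (assembly hP)

/-- Two-piece form: given `h₂`, one of the two pieces is (materially) anti-Liouville. -/
theorem split_some_piece_anti_L {P₁ P₂ : Prop} (assembly : P₁ → P₂ → ViscousContinuation)
    (h₂ : HalfSpaceHierarchy) : (P₁ → ¬ L) ∨ (P₂ → ¬ L) := by
  by_cases hp : P₁
  · exact Or.inr fun p2 => route_requires_not_L h₂ (assembly hp p2)
  · exact Or.inl fun p1 => (hp p1).elim

/-- Three-piece form. -/
theorem split3_some_piece_anti_L {P₁ P₂ P₃ : Prop} (assembly : P₁ → P₂ → P₃ → ViscousContinuation)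
    (h₂ : HalfSpaceHierarchy) : (P₁ → ¬ L) ∨ (P₂ → ¬ L) ∨ (P₃ → ¬ L) := by
  by_cases hp : P₁
  · exact Or.inr (split_some_piece_anti_L (assembly hp) h₂)
  · exact Or.inl fun p1 => (hp p1).elim

/-! ## §2 Strengthen -/

/-- Euler-side piece of the registered zero-stress split (`stub_halfTurnSymmetricHierarchy` ⊇ this):
some hierarchy ⇒ a ZERO-STRESS hierarchy. -/
def StressRemoval : Prop := HalfSpaceHierarchy → ∃ V Q C F, HierarchyBody V Q C F ∧ ZeroStress V

/-- Navier–Stokes-side piece of the registered split (= `stub_zeroStressContinuation` up to the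
spelling of the clause blocks): a zero-stress hierarchy continues to a viscous wall profile. -/
def ZeroStressContinuation : Prop :=
  (∃ V Q C F, HierarchyBody V Q C F ∧ ZeroStress V) → ViscousWallProfile

/-- The split direction used by the line: both pieces give the crux (pure logic). -/
theorem crux_of_split (hR : StressRemoval) (hC : ZeroStressContinuation) : ViscousContinuation :=
  fun h2 => hC (hR h2)

/-- **S⁺₁ (the honest constructive form): continue THE given zero-stress hierarchy** — no
re-quantification of `(V, Q)` in the conclusion. -/
def GivenFieldContinuation : Prop :=
  ∀ (V : E3 → E3) (Q : E3 → ℝ) (C F : ℝ), HierarchyBody V Q C F → ZeroStress V →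
    ∃ (W : E3 → E3) (P : E3 → ℝ) (C' : ℝ), ViscousBody W P V Q C'

theorem zeroStressContinuation_of_givenField (h : GivenFieldContinuation) : ZeroStressContinuation := by
  rintro ⟨V, Q, C, F, hB, hZ⟩
  obtain ⟨W, P, C', hV⟩ := h V Q C F hB hZ
  exact viscousWallProfile_iff.2 ⟨W, P, V, Q, C, F, C', hB, hV⟩

/-- S⁺₁ on any inhabited hypothesis refutes (L): the added rigidity does not touch the Liouville
content. -/
theorem givenField_requires_not_L (h : GivenFieldContinuation)
    (hZ : ∃ V Q C F, HierarchyBody V Q C F ∧ ZeroStress V) : ¬ L := fun hL =>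
  ViscousWallProfile_false_of_LiouvilleConjectureNS hL (zeroStressContinuation_of_givenField h hZ)

/-- **S⁺₂ / regime restriction: the crux restricted to SMALL energy flux `|F| < δ`.** -/
def SmallFluxContinuation (δ : ℝ) : Prop :=
  (∃ V Q C F, HierarchyBody V Q C F ∧ |F| < δ) → ViscousWallProfile

/-- Differentiability of a field that is smooth on the open half-space (bookkeeping). -/
theorem differentiableAt_of_smoothOn {F' : Type*} [NormedAddCommGroup F'] [NormedSpace ℝ F']
    {f : E3 → F'} (hf : ContDiffOn ℝ ((⊤ : ℕ∞) : WithTop ℕ∞) f {X : E3 | 0 < X 2})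
    (X : E3) (hX : 0 < X 2) : DifferentiableAt ℝ f X := by
  have hHopen : IsOpen {X : E3 | 0 < X 2} :=
    isOpen_lt continuous_const (PiLp.continuous_apply 2 (fun _ : Fin 3 => ℝ) (2 : Fin 3))
  exact (hf.differentiableOn (by simp) X hX).differentiableAt (hHopen.mem_nhds hX)

/-- **Amplitude scaling of hierarchies**: `(V, Q, C, F) ↦ (tV, t²Q, (t + t²)|C|, t³F)` maps
hierarchies to hierarchies for every `t > 0` (steady Euler is quadratic, every other clause is
linear or homogeneous).  Hence `|F|` can be made arbitrarily small or large inside the class. -/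
theorem hierarchyBody_smul {V : E3 → E3} {Q : E3 → ℝ} {C F : ℝ} (h : HierarchyBody V Q C F)
    {t : ℝ} (ht : 0 < t) :
    HierarchyBody (fun X => t • V X) (fun X => (t ^ 2) • Q X) ((t + t ^ 2) * |C|) (t ^ 3 * F) := by
  dsimp only [HierarchyBody] at h ⊢
  obtain ⟨hVs, hQs, hbd, hdiv, hE, hdil, hper, hmass, hF, hflux⟩ := h
  have ht2 : 0 < t ^ 2 := by positivity
  refine ⟨hVs.const_smul t, hQs.const_smul (t ^ 2), ?_, ?_, ?_, ?_, ?_, ?_, ?_, ?_⟩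
  · -- bounds
    intro X hX
    obtain ⟨h1, h2⟩ := hbd X hX
    have hC : C ≤ |C| := le_abs_self C
    have hVn : 0 ≤ ‖V X‖ := norm_nonneg _
    refine ⟨?_, ?_⟩
    · rw [norm_smul, Real.norm_eq_abs, abs_of_pos ht]
      nlinarith [mul_le_mul_of_nonneg_left (h1.trans hC) ht.le, abs_nonneg C]
    · rw [smul_eq_mul, abs_mul, abs_of_pos ht2]
      nlinarith [mul_le_mul_of_nonneg_left (h2.trans hC) ht2.le, abs_nonneg C]
  · -- divergence
    intro X hX
    have hd : DifferentiableAt ℝ V X := differentiableAt_of_smoothOn hVs X hX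
    have h0 := hdiv X hX
    rw [fderiv_fun_const_smul hd t]
    simp only [ContinuousLinearMap.coe_smul', Pi.smul_apply, PiLp.smul_apply, smul_eq_mul]
    rw [← Finset.mul_sum, h0, mul_zero]
  · -- Euler
    intro X hX
    have hd : DifferentiableAt ℝ V X := differentiableAt_of_smoothOn hVs X hX
    have hq : DifferentiableAt ℝ Q X := differentiableAt_of_smoothOn hQs X hX
    have h0 := hE X hX
    have hg : gradient (fun Y => (t ^ 2) • Q Y) X = (t ^ 2) • gradient Q X := by
      simp only [gradient, fderiv_fun_const_smul hq, map_smulₛₗ, starRingEnd_apply, star_trivial]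
    rw [fderiv_fun_const_smul hd t, hg]
    simp only [ContinuousLinearMap.coe_smul', Pi.smul_apply, map_smul]
    rw [smul_smul, ← pow_two, ← smul_add, h0, smul_zero]
  · -- dilation invariance
    intro X hX
    obtain ⟨h1, h2⟩ := hdil X hX
    exact ⟨by rw [h1], by rw [h2]⟩
  · -- band periodicity
    intro X hX1 hX2
    obtain ⟨h1, h2, h3, h4⟩ := hper X hX1 hX2
    exact ⟨by rw [h1], by rw [h2], by rw [h3], by rw [h4]⟩
  · -- zero mass flux
    simp only [PiLp.smul_apply, smul_eq_mul]
    rw [integral_const_mul, hmass, mul_zero]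
  · -- non-zero energy flux
    exact mul_ne_zero (pow_ne_zero 3 ht.ne') hF
  · -- energy flux value
    have hpt : ∀ q : ℝ × ℝ,
        (t • V !₂[q.1, q.2, (1 : ℝ)]) 2 *
            (‖t • V !₂[q.1, q.2, (1 : ℝ)]‖ ^ 2 / 2 + (t ^ 2) • Q !₂[q.1, q.2, (1 : ℝ)]) =
          t ^ 3 * ((V !₂[q.1, q.2, (1 : ℝ)]) 2 *
            (‖V !₂[q.1, q.2, (1 : ℝ)]‖ ^ 2 / 2 + Q !₂[q.1, q.2, (1 : ℝ)])) := by
      intro q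
      rw [PiLp.smul_apply, smul_eq_mul, smul_eq_mul, norm_smul, Real.norm_eq_abs, abs_of_pos ht]
      ring
    rw [integral_congr_ae (Eventually.of_forall hpt), integral_const_mul, hflux]

/-- **The small-flux restriction is the whole crux** (for every `δ > 0`): the hypothesis class has
no perturbative regime — amplitude is a symmetry. -/
theorem smallFluxContinuation_iff {δ : ℝ} (hδ : 0 < δ) :
    SmallFluxContinuation δ ↔ ViscousContinuation := by
  constructor
  · intro hS h2
    obtain ⟨V, Q, C, F, hB⟩ := halfSpaceHierarchy_iff.1 h2
    -- choose `t ∈ (0, 1]` with `t |F| < δ`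
    obtain ⟨c, hc, hcF⟩ := exists_pos_mul_lt hδ |F|
    set t : ℝ := min c 1 with ht_def
    have ht : 0 < t := lt_min hc one_pos
    have ht1 : t ≤ 1 := min_le_right _ _
    have htc : t ≤ c := min_le_left _ _
    have hsmall : |t ^ 3 * F| < δ := by
      rw [abs_mul, abs_of_pos (pow_pos ht 3)]
      have hF0 : 0 ≤ |F| := abs_nonneg F
      have h3 : t ^ 3 ≤ t := by
        have : t ^ 2 ≤ 1 := pow_le_one₀ ht.le ht1
        nlinarith
      calc t ^ 3 * |F| ≤ t * |F| := mul_le_mul_of_nonneg_right h3 hF0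
        _ ≤ c * |F| := mul_le_mul_of_nonneg_right htc hF0
        _ = |F| * c := mul_comm _ _
        _ < δ := hcF
    exact hS ⟨_, _, _, _, hierarchyBody_smul hB ht, hsmall⟩
  · rintro h ⟨V, Q, C, F, hB, -⟩
    exact h (halfSpaceHierarchy_iff.2 ⟨V, Q, C, F, hB⟩)

/-! ## §3 Decomposition: far field / capping -/

/-- A FAR-FIELD viscous continuation of `(V, Q)`: steady Navier–Stokes at `ν = 1` without force on
the open set `{z > Z₀}` only, bounded there, converging to `(V, Q)` uniformly as `z → +∞`. -/
def FarFieldSolution (W : E3 → E3) (P : E3 → ℝ) (V : E3 → E3) (Q : E3 → ℝ) (C' Z₀ : ℝ) : Prop :=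
  let U : Set (EuclideanSpace ℝ (Fin 3)) := {X | Z₀ < X 2}
  let e : Fin 3 → EuclideanSpace ℝ (Fin 3) := fun i => EuclideanSpace.single i (1 : ℝ)
  ContDiffOn ℝ ((⊤ : ℕ∞) : WithTop ℕ∞) W U ∧ ContDiffOn ℝ ((⊤ : ℕ∞) : WithTop ℕ∞) P U ∧
  (∀ X ∈ U, ‖W X‖ ≤ C' ∧ |P X| ≤ C') ∧
  (∀ X ∈ U, ∑ i : Fin 3, (fderiv ℝ W X (e i)) i = 0) ∧
  (∀ X ∈ U, (fderiv ℝ W X) (W X) + gradient P X =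
    ∑ i : Fin 3, fderiv ℝ (fun Y => fderiv ℝ W Y (e i)) X (e i)) ∧
  (∀ ε : ℝ, 0 < ε → ∃ Z : ℝ, ∀ X : EuclideanSpace ℝ (Fin 3), Z ≤ X 2 →
    ‖W X - V X‖ ≤ ε ∧ |P X - Q X| ≤ ε)

/-- **D-piece A (far field / unstable manifold of the hierarchy under viscosity):** every
zero-stress hierarchy has a far-field viscous continuation.  A steady SINGULAR-PERTURBATION
statement at an object no method can produce (crux #2); does NOT contradict (L) (not entire). -/
def FarFieldContinuation : Prop :=
  ∀ (V : E3 → E3) (Q : E3 → ℝ) (C F : ℝ), HierarchyBody V Q C F → ZeroStress V →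
    ∃ (W : E3 → E3) (P : E3 → ℝ) (C' Z₀ : ℝ), FarFieldSolution W P V Q C' Z₀

/-- **D-piece B (capping):** every far-field viscous continuation of a hierarchy can be replaced
by an ENTIRE bounded mirror-symmetric one with the same blow-down.  This piece carries the whole
Liouville content (`capping_requires_not_L`). -/
def Capping : Prop :=
  ∀ (V : E3 → E3) (Q : E3 → ℝ) (C F : ℝ) (W : E3 → E3) (P : E3 → ℝ) (C' Z₀ : ℝ),
    HierarchyBody V Q C F → FarFieldSolution W P V Q C' Z₀ →
    ∃ (W' : E3 → E3) (P' : E3 → ℝ) (C'' : ℝ), ViscousBody W' P' V Q C''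

/-- Assembly of the far-field / capping split (pure logic; `trivial_seam`). -/
theorem zeroStressContinuation_of_farField_capping (hA : FarFieldContinuation) (hB : Capping) :
    ZeroStressContinuation := by
  rintro ⟨V, Q, C, F, hH, hZ⟩
  obtain ⟨W, P, C', Z₀, hfar⟩ := hA V Q C F hH hZ
  obtain ⟨W', P', C'', hV⟩ := hB V Q C F W P C' Z₀ hH hfar
  exact viscousWallProfile_iff.2 ⟨W', P', V, Q, C, F, C'', hH, hV⟩

/-- Hence the three-piece chain `StressRemoval → FarFieldContinuation → Capping → crux`. -/
theorem crux_of_farField_capping (hR : StressRemoval) (hA : FarFieldContinuation) (hB : Capping) :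
    ViscousContinuation :=
  crux_of_split hR (zeroStressContinuation_of_farField_capping hA hB)

/-- **The capping piece is anti-Liouville on any inhabited hypothesis.** -/
theorem capping_requires_not_L (hB : Capping)
    (hfar : ∃ (V : E3 → E3) (Q : E3 → ℝ) (C F : ℝ) (W : E3 → E3) (P : E3 → ℝ) (C' Z₀ : ℝ),
      HierarchyBody V Q C F ∧ FarFieldSolution W P V Q C' Z₀) : ¬ L := by
  intro hL
  obtain ⟨V, Q, C, F, W, P, C', Z₀, hH, hf⟩ := hfar
  obtain ⟨W', P', C'', hV⟩ := hB V Q C F W P C' Z₀ hH hf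
  exact ViscousWallProfile_false_of_LiouvilleConjectureNS hL
    (viscousWallProfile_iff.2 ⟨W', P', V, Q, C, F, C'', hH, hV⟩)

/-- And given `h₂`, one of the three pieces is (materially) anti-Liouville. -/
theorem farField_split_some_piece_anti_L (h₂ : HalfSpaceHierarchy) :
    (StressRemoval → ¬ L) ∨ (FarFieldContinuation → ¬ L) ∨ (Capping → ¬ L) :=
  split3_some_piece_anti_L crux_of_farField_capping h₂

/-! ## §4 Negation -/

/-- **What an unconditional refutation of the crux must contain: a PROOF of crux #2** (Grad-class,
see `Cruxes/HalfSpaceHierarchy/STRATEGY-CENSUS.md`) and a Liouville theorem for the profile class. -/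
theorem not_crux_iff : ¬ ViscousContinuation ↔ (HalfSpaceHierarchy ∧ ¬ ViscousWallProfile) := by
  rw [viscousContinuation_iff, Classical.not_imp]

/-- Conversely (L) alone does NOT refute the crux: it turns it into `¬ crux #2` (see
`crux_iff_not_hsh_of_L`); so the negation side is blocked on the Euler side regardless of any
progress on Liouville theorems. -/
theorem not_crux_of_L_iff (hL : L) : ¬ ViscousContinuation ↔ HalfSpaceHierarchy := by
  rw [crux_iff_not_hsh_of_L hL, not_not]

end Summit.AnomalousDissipation.AnomalousDissipation.Cruxes.ViscousContinuation.StrategyCensus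

end
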